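import Summits.Schanuel.Schanuel.Theorems.ZilberEacAlgebraicLogTranscendenceParam
import Summits.Schanuel.Schanuel.Theorems.ZilberEacNewtonBranch
import Summits.Schanuel.Schanuel.Theorems.ZilberEacGraphUnramifiedBranch
import Summits.Schanuel.Schanuel.Theorems.ZilberEacGraphReciprocalExamples
import HarnessLib

/-!
# The equimodular class, L: fibre curves with a simple nonzero top-row root and a NEWTON-SIMPLE
# (possibly ramified) zero or pole are dense — the reciprocal quartic `x₀y₀⁴ + y₀² - x₀ = 0`

HONEST FRAMING.  Cell `pub-schanuel` (Zilber's Exponential-Algebraic Closedness, case ladder;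
host summit Schanuel), seat 2, gen 25.  **`unprojectedDense_graph_newtonBranch`**: let
`p ∈ ℂ[X]` have degree `≥ 2`, let `P(x₀, y₀) = Q(x₀)(y₀)` be irreducible with rows of degree `≤ N`
and a SIMPLE NONZERO root `θ` of the top row, and suppose ONE Newton–Puiseux step exhibits a zero
or a pole of the fibre curve: for some `a`, `e, μ ≥ 1`, `ν` and `Q̃ ∈ ℂ[s][t]` with a simple nonzero
root `w₀` of `Q̃(0)(·)`, either `Q(a + t^e)(t^μ w) = t^ν Q̃(t)(w)` (zero) or
`(t^μ w)^r Q(a + t^e)(1/(t^μ w)) = t^ν Q̃(t)(w)`, `q₀ ≠ 0` (pole), for all `t, w ≠ 0`.  Then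
`{x₁ = p(x₀), P = 0}` has Zariski-dense exponential points (files XXVII, XLVIII, XLIX).  This
extends file XLIV from unramified to RAMIFIED zeros/poles.  Example
(**`unprojectedDensityQuestion_graph_quarticReciprocalFibre`**): **`{x₁ = p(x₀), x₀y₀⁴ + y₀² - x₀ = 0}`**
— reciprocal type (`q₀ = -q₄`), `q₁ = q₃ = 0`, so its zero AND its pole over `x₀ = 0` are ramified
(`y₀² ∼ x₀`): outside files XLIII–XLVI; dense via `x₀ = t²`, `y₀ = t·w`, `Q̃ = t⁴w⁴ + w² - 1`,
`w₀ = 1`.  Complete classes of instances of an OPEN question (Mantova–Masser, PLMS 2024 §1 p. 5);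
EC(3,2) OPEN; NOT Schanuel's conjecture (neither used nor implied; EAC ⇏ SC).
-/

noncomputable section

open Filter Topology Set Complex MvPolynomial
open Literature.NumberTheory.Transcendental Literature.ModelTheory.Zilber
open Literature.ModelTheory.ExponentialFields

set_option linter.dupNamespace false

namespace Summit.Schanuel.Schanuel.Theorems

/-! ## Part A. The surface theorem -/

/-- **Fibre curves with a simple nonzero top-row root and a Newton-simple zero or pole are dense over
polynomial graphs of degree `≥ 2`.**  See the module docstring.
[cite: MantovaMasser2023, §1 Further remarks, p. 5 (the question, open in general)] (new) -/
theorem unprojectedDense_graph_newtonBranch (Q : Polynomial (Polynomial ℂ))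
    {P : MvPolynomial (Fin 2) ℂ}
    (hP : ∀ x y : ℂ, MvPolynomial.eval ![x, y] P = (Q.map (Polynomial.evalRingHom x)).eval y)
    (hirr : Irreducible P) (N : ℕ) (hN : ∀ j, (Q.coeff j).natDegree ≤ N) (T : Polynomial ℂ)
    (hT : ∀ j, T.coeff j = (Q.coeff j).coeff N) (hT0 : T ≠ 0) {θ : ℂ} (hθ0 : θ ≠ 0)
    (hTθ : T.IsRoot θ) (hT'θ : (Polynomial.derivative T).eval θ ≠ 0)
    (a : ℂ) {e μ ν : ℕ} (he : 1 ≤ e) (hμ : 1 ≤ μ) (Qt : Polynomial (Polynomial ℂ)) {w₀ : ℂ}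
    (hw₀ : w₀ ≠ 0) (hroot : (Qt.map (Polynomial.evalRingHom 0)).IsRoot w₀)
    (hsimple : ¬ ((Polynomial.derivative Qt).map (Polynomial.evalRingHom 0)).IsRoot w₀)
    (hid : (∀ t w : ℂ, t ≠ 0 → w ≠ 0 →
        (Q.map (Polynomial.evalRingHom (a + t ^ e))).eval (t ^ μ * w) =
          t ^ ν * (Qt.map (Polynomial.evalRingHom t)).eval w) ∨
      (Q.coeff 0 ≠ 0 ∧ ∀ t w : ℂ, t ≠ 0 → w ≠ 0 →
        (t ^ μ * w) ^ Q.natDegree * (Q.map (Polynomial.evalRingHom (a + t ^ e))).eval (t ^ μ * w)⁻¹ =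
          t ^ ν * (Qt.map (Polynomial.evalRingHom t)).eval w))
    (p : Polynomial ℂ) (hd : 2 ≤ p.natDegree) :
    UnprojectedDense {w : Fin 2 ⊕ Fin 2 → ℂ | w (Sum.inl 1) = p.eval (w (Sum.inl 0)) ∧
      MvPolynomial.eval ![w (Sum.inl 0), w (Sum.inr 0)] P = 0} := by
  classical
  by_contra hnot
  have hQirr : Irreducible Q := (irreducible_rows_iff hP).1 hirr
  have hQ1 : Q.natDegree ≠ 0 := fun h =>
    natDegree_ne_zero_of_isRoot hT0 hTθ (Nat.le_zero.1 (h ▸ natDegree_topRow_le Q N T hT))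
  obtain ⟨ψ, δ, hδ, -, -, hψball, hψroot, -, hψalg⟩ :=
    exists_algebraic_branchLog_of_not_dense Q hP hirr N hN T hT hT0 hθ0 hTθ hT'θ p hd hnot
  set z₀ : ℂ := ((δ⁻¹ + 1 : ℝ) : ℂ) with hz₀def
  have hz₀ : δ⁻¹ < ‖z₀‖ := by
    rw [hz₀def, Complex.norm_real, Real.norm_eq_abs, abs_of_pos (by positivity)]; linarith
  have hgood : ∀ z : ℂ, δ⁻¹ < ‖z‖ → z ≠ 0 ∧ ‖z⁻¹‖ < δ := by
    intro z hz
    have hzpos : 0 < ‖z‖ := lt_trans (by positivity) hz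
    refine ⟨norm_pos_iff.1 hzpos, ?_⟩
    rw [norm_inv]
    calc ‖z‖⁻¹ < (δ⁻¹)⁻¹ := (inv_lt_inv₀ hzpos (by positivity)).2 hz
      _ = δ := inv_inv δ
  have hnear : ∀ᶠ y in 𝓝 z₀, δ⁻¹ < ‖y‖ :=
    (continuous_norm.continuousAt (x := z₀)).eventually (lt_mem_nhds hz₀)
  obtain ⟨hLan, hLalg⟩ := hψalg z₀ hz₀
  set ρ : ℂ → ℂ := fun z => ψ z⁻¹ with hρ
  have hρfacts : ∀ z : ℂ, δ⁻¹ < ‖z‖ → AnalyticAt ℂ ρ z ∧ ρ z ≠ 0 ∧ ρ z / θ ∈ Complex.slitPlane ∧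
      (Q.map (Polynomial.evalRingHom z)).eval (ρ z) = 0 := by
    intro z hz
    obtain ⟨hz0, hzu⟩ := hgood z hz
    obtain ⟨han, hne, hslit⟩ := hψball z⁻¹ hzu
    have hroot' := hψroot z⁻¹ hzu (inv_ne_zero hz0)
    rw [inv_inv] at hroot'
    exact ⟨han.comp (analyticAt_inv hz0), hne, hslit, hroot'⟩
  have hρan : AnalyticAt ℂ ρ z₀ := (hρfacts z₀ hz₀).1
  have hρ0 : ρ z₀ ≠ 0 := (hρfacts z₀ hz₀).2.1
  have hQρ : ∀ᶠ z in 𝓝 z₀, (Q.map (Polynomial.evalRingHom z)).eval (ρ z) = 0 := by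
    filter_upwards [hnear] with z hz using (hρfacts z hz).2.2.2
  have hL : ∀ᶠ z in 𝓝 z₀, HasDerivAt (fun y => Complex.log (ψ y⁻¹ / θ)) (deriv ρ z / ρ z) z := by
    filter_upwards [hnear] with z hz
    obtain ⟨han, hne, hslit, -⟩ := hρfacts z hz
    have hρd : HasDerivAt ρ (deriv ρ z) z := han.differentiableAt.hasDerivAt
    have hlog := (hρd.div_const θ).clog hslit
    refine hlog.congr_deriv ?_
    rw [div_div_div_cancel_right₀ hθ0]
  have hγan : AnalyticAt ℂ (fun t : ℂ => a + t ^ e) 0 := analyticAt_const.add (analyticAt_id.pow e)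
  have hγ' := deriv_newtonBase_ne_zero a he
  rcases hid with hid | ⟨hQ00, hid⟩
  · obtain ⟨η, hηan, hη0, hηne, hQη⟩ := exists_newtonBranch Q Qt a hμ hid hw₀ hroot hsimple
    exact not_isAlgebraic_log_algebraicBranch_param Q hQirr hQ1 hγan hηan hη0 hγ' hηne hQη hρan hLan
      hρ0 hQρ hL hLalg
  · obtain ⟨η, hηan, hη0, hηne, hQη⟩ := exists_newtonBranch_pole Q Qt a hμ hid hw₀ hroot hsimple
    exact not_isAlgebraic_log_algebraicBranch_param_pole Q hQirr hQ1 hQ00 hγan hηan hη0 hγ' hηne hQη hρan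
      hLan hρ0 hQρ hL hLalg

/-! ## Part B. Quartic fibres -/

/-- Coefficients of a quartic in `ℂ[s][t]`. [folklore] -/
theorem coeff_quarticRows (q₀ q₁ q₂ q₃ q₄ : Polynomial ℂ) (j : ℕ) :
    (Polynomial.C q₄ * Polynomial.X ^ 4 + Polynomial.C q₃ * Polynomial.X ^ 3 + Polynomial.C q₂ * Polynomial.X ^ 2 +
        Polynomial.C q₁ * Polynomial.X + Polynomial.C q₀ : Polynomial (Polynomial ℂ)).coeff j =
      if j = 4 then q₄ else if j = 3 then q₃ else if j = 2 then q₂ else if j = 1 then q₁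
        else if j = 0 then q₀ else 0 := by
  simp only [Polynomial.coeff_add, Polynomial.coeff_C_mul, Polynomial.coeff_X_pow, Polynomial.coeff_X,
    Polynomial.coeff_C]
  rcases j with _ | _ | _ | _ | _ | j <;> simp

/-- **Quartic fibres with a simple nonzero top-row root and a Newton-simple zero are dense over
polynomial graphs of degree `≥ 2`** (file L specialised; zero form).
[cite: MantovaMasser2023, §1 Further remarks, p. 5 (the question, open in general)] (new) -/
theorem unprojectedDense_graph_quarticFibre_newton (q₀ q₁ q₂ q₃ q₄ : Polynomial ℂ)
    {P : MvPolynomial (Fin 2) ℂ}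
    (hP : ∀ x y : ℂ, MvPolynomial.eval ![x, y] P =
      q₄.eval x * y ^ 4 + q₃.eval x * y ^ 3 + q₂.eval x * y ^ 2 + q₁.eval x * y + q₀.eval x)
    (hirr : Irreducible P) (N : ℕ) (hN₄ : q₄.natDegree ≤ N) (hN₃ : q₃.natDegree ≤ N)
    (hN₂ : q₂.natDegree ≤ N) (hN₁ : q₁.natDegree ≤ N) (hN₀ : q₀.natDegree ≤ N) (ht : q₄.coeff N ≠ 0)
    {θ : ℂ} (hθ0 : θ ≠ 0)
    (hTθ : (Polynomial.C (q₄.coeff N) * Polynomial.X ^ 4 + Polynomial.C (q₃.coeff N) * Polynomial.X ^ 3 +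
      Polynomial.C (q₂.coeff N) * Polynomial.X ^ 2 + Polynomial.C (q₁.coeff N) * Polynomial.X +
      Polynomial.C (q₀.coeff N)).IsRoot θ)
    (hT'θ : (Polynomial.derivative (Polynomial.C (q₄.coeff N) * Polynomial.X ^ 4 +
      Polynomial.C (q₃.coeff N) * Polynomial.X ^ 3 + Polynomial.C (q₂.coeff N) * Polynomial.X ^ 2 +
      Polynomial.C (q₁.coeff N) * Polynomial.X + Polynomial.C (q₀.coeff N))).eval θ ≠ 0)
    (a : ℂ) {e μ ν : ℕ} (he : 1 ≤ e) (hμ : 1 ≤ μ) (Qt : Polynomial (Polynomial ℂ)) {w₀ : ℂ}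
    (hw₀ : w₀ ≠ 0) (hroot : (Qt.map (Polynomial.evalRingHom 0)).IsRoot w₀)
    (hsimple : ¬ ((Polynomial.derivative Qt).map (Polynomial.evalRingHom 0)).IsRoot w₀)
    (hid : ∀ t w : ℂ, t ≠ 0 → w ≠ 0 →
      q₄.eval (a + t ^ e) * (t ^ μ * w) ^ 4 + q₃.eval (a + t ^ e) * (t ^ μ * w) ^ 3 +
        q₂.eval (a + t ^ e) * (t ^ μ * w) ^ 2 + q₁.eval (a + t ^ e) * (t ^ μ * w) + q₀.eval (a + t ^ e) =
        t ^ ν * (Qt.map (Polynomial.evalRingHom t)).eval w)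
    (p : Polynomial ℂ) (hd : 2 ≤ p.natDegree) :
    UnprojectedDense {w : Fin 2 ⊕ Fin 2 → ℂ | w (Sum.inl 1) = p.eval (w (Sum.inl 0)) ∧
      MvPolynomial.eval ![w (Sum.inl 0), w (Sum.inr 0)] P = 0} := by
  classical
  set Q : Polynomial (Polynomial ℂ) := Polynomial.C q₄ * Polynomial.X ^ 4 + Polynomial.C q₃ * Polynomial.X ^ 3 +
    Polynomial.C q₂ * Polynomial.X ^ 2 + Polynomial.C q₁ * Polynomial.X + Polynomial.C q₀ with hQ
  set T : Polynomial ℂ := Polynomial.C (q₄.coeff N) * Polynomial.X ^ 4 + Polynomial.C (q₃.coeff N) * Polynomial.X ^ 3 +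
    Polynomial.C (q₂.coeff N) * Polynomial.X ^ 2 + Polynomial.C (q₁.coeff N) * Polynomial.X +
    Polynomial.C (q₀.coeff N) with hTdef
  have hQeval : ∀ x y : ℂ, (Q.map (Polynomial.evalRingHom x)).eval y =
      q₄.eval x * y ^ 4 + q₃.eval x * y ^ 3 + q₂.eval x * y ^ 2 + q₁.eval x * y + q₀.eval x := by
    intro x y
    simp only [hQ, Polynomial.map_add, Polynomial.map_mul, Polynomial.map_C, Polynomial.map_pow,
      Polynomial.map_X, Polynomial.coe_evalRingHom, Polynomial.eval_add, Polynomial.eval_mul,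
      Polynomial.eval_C, Polynomial.eval_pow, Polynomial.eval_X]
  have hPQ : ∀ x y : ℂ, MvPolynomial.eval ![x, y] P = (Q.map (Polynomial.evalRingHom x)).eval y := by
    intro x y; rw [hP, hQeval]
  have hcoefQ : ∀ j, Q.coeff j = if j = 4 then q₄ else if j = 3 then q₃ else if j = 2 then q₂
      else if j = 1 then q₁ else if j = 0 then q₀ else 0 := fun j => coeff_quarticRows q₀ q₁ q₂ q₃ q₄ j
  have hcoefT : ∀ j, T.coeff j = if j = 4 then q₄.coeff N else if j = 3 then q₃.coeff N
      else if j = 2 then q₂.coeff N else if j = 1 then q₁.coeff N else if j = 0 then q₀.coeff N else 0 := by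
    intro j
    simp only [hTdef, Polynomial.coeff_add, Polynomial.coeff_C_mul, Polynomial.coeff_X_pow, Polynomial.coeff_X,
      Polynomial.coeff_C]
    rcases j with _ | _ | _ | _ | _ | j <;> simp
  have hN : ∀ j, (Q.coeff j).natDegree ≤ N := by
    intro j
    rw [hcoefQ]
    split_ifs
    · exact hN₄
    · exact hN₃
    · exact hN₂
    · exact hN₁
    · exact hN₀
    · simp
  have hT : ∀ j, T.coeff j = (Q.coeff j).coeff N := by
    intro j
    rw [hcoefT, hcoefQ]
    split_ifs <;> simp
  have hT0 : T ≠ 0 := by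
    intro h
    have := congrArg (fun q : Polynomial ℂ => q.coeff 4) h
    simp only [hcoefT, Polynomial.coeff_zero] at this
    exact ht (by simpa using this)
  refine unprojectedDense_graph_newtonBranch Q hPQ hirr N hN T hT hT0 hθ0 hTθ hT'θ a (ν := ν) he hμ Qt hw₀
    hroot hsimple (Or.inl fun t w ht' hw => ?_) p hd
  rw [hQeval]
  exact hid t w ht' hw

/-! ## Part C. The example -/

/-- `x₀y₀⁴ + y₀² - x₀` is irreducible. -/
theorem irreducible_quarticReciprocalFibre :
    Irreducible (X 0 * X 1 ^ 4 + X 1 ^ 2 - X 0 : MvPolynomial (Fin 2) ℂ) := by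
  have himage : MvPolynomial.finSuccEquiv ℂ 1 (X 0 * X 1 ^ 4 + X 1 ^ 2 - X 0) =
      Polynomial.C (X 0 ^ 4 - 1 : MvPolynomial (Fin 1) ℂ) * Polynomial.X +
        Polynomial.C (X 0 ^ 2 : MvPolynomial (Fin 1) ℂ) := by
    rw [show (X 1 : MvPolynomial (Fin 2) ℂ) = X (Fin.succ 0) from rfl]
    simp only [map_add, map_sub, map_mul, map_pow, map_one, MvPolynomial.finSuccEquiv_X_zero,
      MvPolynomial.finSuccEquiv_X_succ]
    ring
  have ha : (X 0 ^ 4 - 1 : MvPolynomial (Fin 1) ℂ) ≠ 0 := by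
    intro h
    have := congrArg (MvPolynomial.eval fun _ => (0 : ℂ)) h
    simp at this
  have hcop : IsCoprime (X 0 ^ 4 - 1 : MvPolynomial (Fin 1) ℂ) (X 0 ^ 2) := ⟨-1, X 0 ^ 2, by ring⟩
  have hirr := irreducible_C_mul_X_add_C_of_isCoprime ha hcop
  rw [← himage] at hirr
  exact (MulEquiv.irreducible_iff (MvPolynomial.finSuccEquiv ℂ 1).toMulEquiv).1 hirr

/-- **`{x₁ = p(x₀), x₀y₀⁴ + y₀² - x₀ = 0}` — a reciprocal quartic fibre whose zero and pole over
`x₀ = 0` are both RAMIFIED (`y₀² ∼ x₀`) — is in Mantova–Masser's case and DENSE** for every `p` of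
degree `≥ 2` (top row `X⁴ - 1`, `θ = 1`; Newton step `x₀ = t²`, `y₀ = t w`, `Q̃ = t⁴w⁴ + w² - 1`,
`w₀ = 1`). [cite: MantovaMasser2023, §1 Further remarks, p. 5 (the question, open in general)] (new) -/
theorem unprojectedDensityQuestion_graph_quarticReciprocalFibre (p : Polynomial ℂ) (hd : 2 ≤ p.natDegree) :
    MMCaseDimPiOneFree {w : Fin 2 ⊕ Fin 2 → ℂ | w (Sum.inl 1) = p.eval (w (Sum.inl 0)) ∧
      w (Sum.inl 0) * w (Sum.inr 0) ^ 4 + w (Sum.inr 0) ^ 2 - w (Sum.inl 0) = 0} ∧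
    UnprojectedDense {w : Fin 2 ⊕ Fin 2 → ℂ | w (Sum.inl 1) = p.eval (w (Sum.inl 0)) ∧
      w (Sum.inl 0) * w (Sum.inr 0) ^ 4 + w (Sum.inr 0) ^ 2 - w (Sum.inl 0) = 0} := by
  classical
  set P : MvPolynomial (Fin 2) ℂ := X 0 * X 1 ^ 4 + X 1 ^ 2 - X 0 with hPdef
  have hset : {w : Fin 2 ⊕ Fin 2 → ℂ | w (Sum.inl 1) = p.eval (w (Sum.inl 0)) ∧
      w (Sum.inl 0) * w (Sum.inr 0) ^ 4 + w (Sum.inr 0) ^ 2 - w (Sum.inl 0) = 0} =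
      {w : Fin 2 ⊕ Fin 2 → ℂ | w (Sum.inl 1) = p.eval (w (Sum.inl 0)) ∧
        MvPolynomial.eval ![w (Sum.inl 0), w (Sum.inr 0)] P = 0} := by
    ext w
    simp only [Set.mem_setOf_eq, hPdef, MvPolynomial.eval_X, map_add, map_sub, map_mul, map_pow,
      Matrix.cons_val_zero, Matrix.cons_val_one]
  rw [hset]
  have hirr : Irreducible P := irreducible_quarticReciprocalFibre
  have hP : ∀ x y : ℂ, MvPolynomial.eval ![x, y] P =
      (Polynomial.X : Polynomial ℂ).eval x * y ^ 4 + (0 : Polynomial ℂ).eval x * y ^ 3 +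
        (1 : Polynomial ℂ).eval x * y ^ 2 + (0 : Polynomial ℂ).eval x * y +
        (-Polynomial.X : Polynomial ℂ).eval x := by
    intro x y
    simp [hPdef]
    ring
  refine ⟨mmCase_fibreCurveSurface p hd hirr ?_, ?_⟩
  · -- every `t ≠ 0` has a nonzero fibre point
    refine (Set.finite_singleton (0 : ℂ)).infinite_compl.mono ?_
    intro t ht
    simp only [Set.mem_compl_iff, Set.mem_singleton_iff] at ht
    set q : Polynomial ℂ := Polynomial.C t * Polynomial.X ^ 4 + (Polynomial.X ^ 2 - Polynomial.C t) with hq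
    have hlow : (Polynomial.X ^ 2 - Polynomial.C t : Polynomial ℂ).degree < (Polynomial.C t * Polynomial.X ^ 4).degree := by
      rw [Polynomial.degree_C_mul_X_pow 4 ht]
      refine lt_of_le_of_lt (Polynomial.degree_sub_le _ _) ?_
      rw [max_lt_iff]
      refine ⟨?_, lt_of_le_of_lt Polynomial.degree_C_le (by norm_num)⟩
      rw [Polynomial.degree_X_pow]; norm_num
    have hqdeg : 0 < q.degree := by
      rw [hq, Polynomial.degree_add_eq_left_of_degree_lt hlow, Polynomial.degree_C_mul_X_pow 4 ht]
      norm_num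
    obtain ⟨y, hy⟩ := Complex.exists_root hqdeg
    have hy' : t * y ^ 4 + y ^ 2 - t = 0 := by
      have := hy.eq_zero
      simp only [hq, Polynomial.eval_add, Polynomial.eval_sub, Polynomial.eval_mul, Polynomial.eval_C,
        Polynomial.eval_pow, Polynomial.eval_X] at this
      linear_combination this
    refine ⟨y, ?_, ?_⟩
    · rintro rfl
      apply ht
      linear_combination -hy'
    · simp only [hPdef, map_add, map_sub, map_mul, map_pow, MvPolynomial.eval_X, Matrix.cons_val_zero,
        Matrix.cons_val_one]
      exact hy'
  · refine unprojectedDense_graph_quarticFibre_newton (-Polynomial.X) 0 1 0 Polynomial.X hP hirr 1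
      Polynomial.natDegree_X_le (by simp) (by simp) (by simp)
      (by rw [Polynomial.natDegree_neg]; exact Polynomial.natDegree_X_le) (by simp) (θ := 1) one_ne_zero
      ?_ ?_ 0 (e := 2) (μ := 1) (ν := 2) (by norm_num) le_rfl
      (Polynomial.C (Polynomial.X ^ 4) * Polynomial.X ^ 4 + Polynomial.X ^ 2 - 1) (w₀ := 1) one_ne_zero
      ?_ ?_ (fun t w _ _ => ?_) p hd
    · simp [Polynomial.coeff_one]
    · simp [Polynomial.coeff_one]; norm_num
    · simp
    · norm_num [Polynomial.derivative_pow]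
    · simp
      ring

end Summit.Schanuel.Schanuel.Theorems
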